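import Literature.AnabelianGeometry.EtaleTheta.KummerClass

/-!
# The kernel of the Kummer map: classes vanish iff the element has invariant compatible roots

Companion to `EtaleTheta/KummerClass.lean` (the Kummer map `κ : A^H → H¹(H, Λ(A))` of the LANA
report, [cite: LANA2026Report, §6.1 p.31]). The one property of Kummer maps that the anabelian
sources USE is injectivity ("Kummer-faithful", [AbsTopIII] Def. 1.5: "(a) `⋂_{N ≥ 1} N · A(k_H) = {0}`
… (b) the associated Kummer map `A(k_H) → H¹(H, Hom(ℚ/ℤ, A(k̄)))` is an injection" — two conditions
the text calls equivalent). This file PROVES the exact kernel statement behind that equivalence for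
the tree's Kummer class:

* `kummerClassOfRootSystem_eq_zero_iff` : `κ(a) = 0` in `H¹(H, Λ(A))` **iff** `a` admits a
  compatible system of roots ALL OF WHICH ARE `H`-INVARIANT (`RootSystem.IsInvariant`). (⇐): the
  Kummer cocycle of an invariant root system is identically `1`; (⇒): a coboundary `h ↦ h • ζ / ζ`,
  `ζ ∈ Λ(A)`, twists the given root system into an invariant one (`x · ζ⁻¹`).
* `kummerClass_eq_zero_iff` : the same for the Kummer map `kummerClass` of a rootable group;
* `kummerMapFixed_injective_of` : hence the Kummer map `A^H → H¹(H, Λ(A))` is injective as soon as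
  no `a ≠ 1` in `A^H` has a compatible system of `H`-invariant roots — in particular under
  condition (a) "`⋂_N (A^H)^N = 1`" (`kummerMapFixed_injective_of_iInter_pow_eq_bot`), which is the
  direction (a) ⇒ (b) of [AbsTopIII] Def. 1.5 in abstract form (the converse needs finiteness of the
  torsion to assemble rational roots into a COMPATIBLE system and is not asserted here).

Everything is proved; no named facts. Universe: `Type` (Mathlib `groupCohomology`), as in
`KummerClass.lean`.
-/

namespace Literature.AnabelianGeometry.EtaleTheta

open groupCohomology

section Invariant

variable {G : Type*} [Group G] {A : Type*} [CommGroup A] [MulDistribMulAction G A]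
  (H : Subgroup G) {a : A}

/-- A compatible system of roots of `a` is **`H`-invariant** if every root `x_n` is fixed by `H`
(i.e. all the roots lie in `A^H`; then `a = x_1 ∈ A^H` too). [cite: LANA2026Report, §6.1 p.31] -/
def RootSystem.IsInvariant (x : RootSystem a) : Prop := ∀ (n : ℕ+) (h : H), (h : G) • x.root n = x.root n

/-- An invariant root system is a root system of an invariant element. [cite: LANA2026Report, §6.1 p.31] -/
theorem RootSystem.IsInvariant.mem_fixedPoints {x : RootSystem a} (hx : x.IsInvariant H) :
    a ∈ MulAction.fixedPoints H A := by
  intro h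
  change (h : G) • a = a
  rw [← x.root_one]
  exact hx 1 h

/-- The Kummer cocycle of an `H`-invariant root system is trivial. [cite: LANA2026Report, §6.1 p.31] -/
theorem RootSystem.kummerCocycle_eq_one_of_isInvariant (x : RootSystem a) (hx : x.IsInvariant H)
    (ha : a ∈ MulAction.fixedPoints H A) (h : H) : x.kummerCocycle ha h = 1 :=
  Subtype.ext (funext fun n => by
    change ((h : G) • x.root n) / x.root n = 1
    rw [hx n h, div_self'])

/-- Twisting a root system by `ζ⁻¹`, where `ζ ∈ Λ(A)` exhibits the Kummer cocycle as a coboundary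
(`h • ζ / ζ = h • x_n / x_n` componentwise), produces an `H`-INVARIANT root system of the same
element. [cite: LANA2026Report, §6.1 p.31] -/
theorem RootSystem.isInvariant_mulCyclotome_inv (x : RootSystem a)
    (ha : a ∈ MulAction.fixedPoints H A) (ζ : cyclotome A)
    (hζ : ∀ h : H, (h : G) • ζ / ζ = x.kummerCocycle ha h) :
    (x.mulCyclotome ζ⁻¹).IsInvariant H := by
  intro n h
  have e := congrArg (fun ξ : cyclotome A => (ξ : ℕ+ → A) n) (hζ h)
  change ((h : G) • (ζ : ℕ+ → A) n) / (ζ : ℕ+ → A) n = ((h : G) • x.root n) / x.root n at e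
  change (h : G) • (x.root n * ((ζ : ℕ+ → A) n)⁻¹) = x.root n * ((ζ : ℕ+ → A) n)⁻¹
  rw [smul_mul', smul_inv', ← div_eq_mul_inv, ← div_eq_mul_inv, div_eq_div_iff_mul_eq_mul]
  rw [div_eq_div_iff_mul_eq_mul] at e
  rw [← e, mul_comm]

end Invariant

section Kernel

variable {G : Type} [Group G] {A : Type} [CommGroup A] [MulDistribMulAction G A]
  (H : Subgroup G) {a : A}

/-- (⇐) The Kummer class computed with an `H`-invariant root system vanishes.
[cite: LANA2026Report, §6.1 p.31] -/
theorem kummerClassOfRootSystem_eq_zero_of_isInvariant (x : RootSystem a) (hx : x.IsInvariant H)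
    (ha : a ∈ MulAction.fixedPoints H A) : kummerClassOfRootSystem H x ha = 0 := by
  have h0 : kummerCocycles₁ H x ha = 0 := by
    refine cocycles₁_ext fun h => ?_
    change Additive.ofMul (x.kummerCocycle ha h) = Additive.ofMul 1
    rw [x.kummerCocycle_eq_one_of_isInvariant H hx ha h]
  rw [kummerClassOfRootSystem, h0, map_zero]

/-- (⇒) If the Kummer class of `a` vanishes then `a` has an `H`-invariant compatible system of roots.
[cite: LANA2026Report, §6.1 p.31] -/
theorem exists_isInvariant_of_kummerClassOfRootSystem_eq_zero (x : RootSystem a)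
    (ha : a ∈ MulAction.fixedPoints H A) (h0 : kummerClassOfRootSystem H x ha = 0) :
    ∃ y : RootSystem a, y.IsInvariant H := by
  obtain ⟨ζ, hζ⟩ :=
    isMulCoboundary₁_of_mem_coboundaries₁ _ ((H1π_eq_zero_iff _).1 h0)
  exact ⟨x.mulCyclotome ζ⁻¹, x.isInvariant_mulCyclotome_inv H ha ζ fun h => hζ h⟩

/-- **The kernel of the Kummer map.** The Kummer class `κ(a) ∈ H¹(H, Λ(A))` of
[cite: LANA2026Report, §6.1 p.31] vanishes iff `a` admits a compatible system of roots all fixed by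
`H` — the exact form of "`⋂_N N · A = 0` versus injectivity of the Kummer map" ([AbsTopIII] Def. 1.5
(a)/(b)). -/
theorem kummerClassOfRootSystem_eq_zero_iff (x : RootSystem a) (ha : a ∈ MulAction.fixedPoints H A) :
    kummerClassOfRootSystem H x ha = 0 ↔ ∃ y : RootSystem a, y.IsInvariant H :=
  ⟨exists_isInvariant_of_kummerClassOfRootSystem_eq_zero H x ha, fun ⟨y, hy⟩ =>
    (kummerClassOfRootSystem_eq H x y ha).trans
      (kummerClassOfRootSystem_eq_zero_of_isInvariant H y hy ha)⟩

variable [RootableBy A ℕ]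

/-- The Kummer map of a rootable group kills exactly the invariants with an `H`-invariant compatible
root system. [cite: LANA2026Report, §6.1 p.31] -/
theorem kummerClass_eq_zero_iff (a : invariants (A := A) H) :
    kummerClass H a = 0 ↔ ∃ y : RootSystem (a : A), y.IsInvariant H :=
  kummerClassOfRootSystem_eq_zero_iff H _ a.2

/-- **Injectivity criterion.** If no `a ≠ 1` in `A^H` admits a compatible system of `H`-invariant
roots, the Kummer map `A^H → H¹(H, Λ(A))` is injective. [cite: LANA2026Report, §6.1 p.31] -/
theorem kummerMapFixed_injective_of
    (hA : ∀ a : invariants (A := A) H, (∃ y : RootSystem (a : A), y.IsInvariant H) → a = 1) :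
    Function.Injective (kummerMapFixed (A := A) H) := by
  refine (injective_iff_map_eq_zero _).2 fun a h0 => ?_
  have h1 : a.toMul = 1 := hA a.toMul ((kummerClass_eq_zero_iff H a.toMul).1 h0)
  rw [← ofMul_toMul a, h1, ofMul_one]

/-- In particular, condition (a) of [AbsTopIII] Def. 1.5 in the abstract form "an element of `A^H`
with `n`-th roots in `A^H` for every `n ≥ 1` is trivial" (`⋂_N (A^H)^N = 1`) implies injectivity of
the Kummer map `A^H → H¹(H, Λ(A))` — direction (a) ⇒ (b); an invariant compatible root system
supplies such roots. [cite: LANA2026Report, §6.1 p.31] -/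
theorem kummerMapFixed_injective_of_iInter_pow_eq_bot
    (hA : ∀ a : invariants (A := A) H,
      (∀ n : ℕ+, ∃ b : invariants (A := A) H, b ^ (n : ℕ) = a) → a = 1) :
    Function.Injective (kummerMapFixed (A := A) H) :=
  kummerMapFixed_injective_of H fun a ⟨y, hy⟩ =>
    hA a fun n => ⟨⟨y.root n, fun h => hy n h⟩, Subtype.ext (y.pow_self n)⟩

end Kernel

end Literature.AnabelianGeometry.EtaleTheta
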